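import Literature.Probability.LatticeModels.LatticeAnimalsGraph
import Mathlib.Analysis.SpecialFunctions.Pow.Real
import Mathlib.Analysis.SpecialFunctions.Sqrt
import Mathlib.Algebra.Order.BigOperators.Group.Finset
import Mathlib.Algebra.Order.Field.GeomSum
import Mathlib.Data.Finset.Powerset
import HarnessLib

/-!
# The cluster-counting union bound behind the LDPC-code threshold theorems (Kovalev–Pryadko 2013, Gottesman 2014)

Topic `Literature/InformationTheory/QuantumCodes`. Theorem-only file (definitions with bodies + proved theorems;
no named fact, no sorry).

Every counting-argument proof of an error-correction threshold for a family of low-density parity-check codes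
(classical or quantum) has the same probabilistic core. Fix a finite graph `G` of maximal degree `≤ Δ` on the set
`V` of (qu)bits (the "connectivity graph": two qubits are adjacent when some check acts on both). If minimum-weight
decoding of a code of distance `d` fails on the error set `E ⊆ V`, then there is a *connected* vertex set `S` with
`|S| ≥ d` at least half of whose vertices are errors, `|S| ≤ 2 |S ∩ E|` (Gottesman 2014, proof of Thm. 3, first claim;
Kovalev–Pryadko 2013, proof of Thm. 3: "violating `(s,m)`-sets", `m ≥ ⌈s/2⌉`; Dennis–Kitaev–Landahl–Preskill 2002
§5.2 is the same half-weight argument for chains on the toric code). That coding-theoretic step is NOT in this file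
(it needs the stabilizer-code vocabulary of `Summits/Ventures/QEC`). What IS here is the second, purely
combinatorial–probabilistic half, proved once and for all:

* `IsLocallyStochastic μ p` — a nonnegative weight `μ` on error sets `E : Finset V` is *locally stochastic with
  parameter `p`* when `∑_{E ⊇ T} μ E ≤ p ^ |T|` for every `T` (Gottesman 2014 §2, "local stochastic error model";
  Fawzi–Grospellier–Leverrier 2018 Def. 8: `ℙ(F ⊆ E) ≤ p^{|F|}`). `bernoulliWeight p E = p^|E| (1-p)^(|V|-|E|)`, the
  i.i.d. model (FGL18 Def. 7), satisfies it with equality (`sum_bernoulliWeight_filter_superset`, `isLocallyStochastic_bernoulliWeight`).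
* `HasDenseCluster G d E` — there is a `G`-connected `S` (in the cut sense `IsGraphConnected` of
  `Literature.Probability.LatticeModels.LatticeAnimalsGraph`) with `d ≤ |S|` and `|S| ≤ 2 |S ∩ E|`.
* `card_connectedOfCard_le` — the number of `G`-connected vertex sets of cardinality `s ≥ 1` is at most
  `|V| · Δ^{2(s-1)}` (each contains a vertex; through a fixed vertex there are at most `Δ^{2(s-1)}` of them — the tree's
  `card_le_pow_of_isGraphConnected`, i.e. the Peierls / lattice-animal entropy bound; the printed proofs use the sharper
  `(Δ e)^{s-1}`-type animal count, which only changes the constant in the threshold).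
* **`sum_hasDenseCluster_le`** (the union bound): for `0 ≤ p ≤ 1` and `μ` locally stochastic with parameter `p`,
  `∑_{E : HasDenseCluster G d E} μ E ≤ ∑_{s = d}^{|V|} |V| · Δ^{2(s-1)} · (2 √p)^s`
  (`2^s` subsets `T ⊆ S` with `2|T| ≥ |S|`, each of weight `≤ p^{|T|} ≤ (√p)^{|S|}`).
* **`sum_hasDenseCluster_le_geometric`**: if moreover `1 ≤ Δ`, `1 ≤ d` and `r := 2 Δ² √p < 1`, the right-hand side is
  `≤ |V| · r^d / (Δ² (1 - r))` — exponentially small in the distance `d`, uniformly in `|V|` up to the linear factor: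
  this is the shape `n_i (p/p₀)^{d_i/2}` of Gottesman 2014 Thm. 3 with `p₀ = (2Δ²)⁻²` in place of the printed
  `(2ze)⁻²`.

Consumers (the typed threshold statements under `Summits/Ventures/QEC/Thresholds`) supply the coding half as the
inclusion `{E : decoding fails} ⊆ {E : HasDenseCluster G d E}` for the code's connectivity graph ("adjacency graph
of the code", Gottesman 2014 §4: qubits adjacent iff some stabilizer generator acts on both; for an `(r,c)`-LDPC
code, Def. 1, its degree is `≤ z = (r-1)c`) and conclude
`P_fail ≤ |V| r^d / (Δ²(1-r)) → 0` along any LDPC family with `d → ∞` and `|V|` polynomial (indeed any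
subexponential) in `d` — a threshold `p₀ = (2Δ²)⁻²` for minimum-weight decoding under local stochastic noise.

## References

* [Gottesman2014] D. Gottesman, *Fault-tolerant quantum computation with constant overhead*, Quantum Inf. Comput. 14
  (2014) 1338–1371, arXiv:1310.2984 — §2 (local stochastic noise), Thm. 3 and its proof (§4).
* [KovalevPryadko2013] A. A. Kovalev, L. P. Pryadko, *Fault tolerance of quantum low-density parity check codes with
  sublinear distance scaling*, Phys. Rev. A 87 (2013) 020304(R), arXiv:1208.2317 — Thm. 3 and its proof.
* [DennisEtAl2002] E. Dennis, A. Kitaev, A. Landahl, J. Preskill, *Topological quantum memory*, J. Math. Phys. 43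
  (2002) 4452–4505, arXiv:quant-ph/0110143 — §5.2 eq. (e_ineq)–(saw_prob) (half-weight bound for chains).
* [FawziGrospellierLeverrier2018] O. Fawzi, A. Grospellier, A. Leverrier, *Efficient decoding of random errors for
  quantum expander codes*, STOC 2018, arXiv:1711.08351 — Def. 8 (local stochastic), Thm. 17 (α-percolation, the
  refined version of the same union bound).
* [FriedliVelenik2017] for the entropy bound, via `Literature.Probability.LatticeModels.LatticeAnimalsGraph`.
-/

open Finset

namespace Literature.InformationTheory.QuantumCodes

open Literature.Probability.LatticeModels

variable {V : Type*} [Fintype V] [DecidableEq V]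

/-! ### Local stochastic weights and the i.i.d. (Bernoulli) weight -/

/-- A nonnegative weight `μ` on error sets `E ⊆ V` is **locally stochastic with parameter `p`** if for every set
`T` of locations the total weight of the error sets containing `T` is at most `p ^ |T|`:
`∑_{E ⊇ T} μ E ≤ p ^ T.card`. For a probability distribution `μ` this is `ℙ(T ⊆ E) ≤ p^{|T|}` — the locations of the
faults are stochastic, the faults themselves arbitrary. (Gottesman 2014 §2 "local stochastic error model";
Fawzi–Grospellier–Leverrier 2018 Def. 8.) [cite: Gottesman2014, §2] -/
def IsLocallyStochastic (μ : Finset V → ℝ) (p : ℝ) : Prop :=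
  (∀ E, 0 ≤ μ E) ∧ ∀ T : Finset V, ∑ E ∈ univ.filter (fun E => T ⊆ E), μ E ≤ p ^ T.card

/-- A locally stochastic weight is nonnegative. [cite: Gottesman2014, §2] -/
theorem IsLocallyStochastic.nonneg {μ : Finset V → ℝ} {p : ℝ} (h : IsLocallyStochastic μ p) (E : Finset V) :
    0 ≤ μ E := h.1 E

/-- The defining bound `∑_{E ⊇ T} μ E ≤ p ^ |T|` of a locally stochastic weight. [cite: Gottesman2014, §2] -/
theorem IsLocallyStochastic.sum_filter_superset_le {μ : Finset V → ℝ} {p : ℝ} (h : IsLocallyStochastic μ p)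
    (T : Finset V) : ∑ E ∈ univ.filter (fun E => T ⊆ E), μ E ≤ p ^ T.card := h.2 T

/-- The **i.i.d. (Bernoulli) weight** of an error set: each of the `|V|` locations is faulty independently with
probability `p`, so `E` has probability `p^|E| (1-p)^(|V|-|E|)`. (The "independent noise error model",
Fawzi–Grospellier–Leverrier 2018 Def. 7; the i.i.d. model of Dennis et al. 2002 §4.1 and Kovalev–Pryadko 2013.)
[cite: FawziGrospellierLeverrier2018, Def 7] -/
def bernoulliWeight (p : ℝ) (E : Finset V) : ℝ := p ^ E.card * (1 - p) ^ (Fintype.card V - E.card)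

omit [DecidableEq V] in
/-- The Bernoulli weight is nonnegative for `0 ≤ p ≤ 1` (it is a probability). [cite: FawziGrospellierLeverrier2018, Def 7] -/
theorem bernoulliWeight_nonneg {p : ℝ} (hp0 : 0 ≤ p) (hp1 : p ≤ 1) (E : Finset V) : 0 ≤ bernoulliWeight p E :=
  mul_nonneg (pow_nonneg hp0 _) (pow_nonneg (sub_nonneg.2 hp1) _)

omit [DecidableEq V] in
/-- The Bernoulli weights sum to `1` (binomial theorem): the independent noise model is a probability
distribution on error sets. [cite: FawziGrospellierLeverrier2018, Def 7] -/
theorem sum_bernoulliWeight (p : ℝ) : ∑ E : Finset V, bernoulliWeight p E = 1 := by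
  have h := Finset.sum_pow_mul_eq_add_pow p (1 - p) (univ : Finset V)
  rw [Finset.powerset_univ] at h
  simp only [Finset.card_univ] at h
  rw [show p + (1 - p) = 1 by ring, one_pow] at h
  simpa [bernoulliWeight] using h

/-- Under the Bernoulli weight the event `T ⊆ E` has probability exactly `p ^ |T|`:
`∑_{E ⊇ T} p^|E| (1-p)^(|V|-|E|) = p^|T|` (substitute `E = T ∪ F`, `F ⊆ Tᶜ`, and use the binomial theorem on `Tᶜ`).
This is the printed remark "Independent noise is always locally decaying" (Gottesman 2014 §2), with equality.
[cite: Gottesman2014, §2] -/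
theorem sum_bernoulliWeight_filter_superset (p : ℝ) (T : Finset V) :
    ∑ E ∈ univ.filter (fun E => T ⊆ E), bernoulliWeight p E = p ^ T.card := by
  classical
  -- reindex the supersets of `T` by their part outside `T`
  have hbij : ∑ E ∈ univ.filter (fun E => T ⊆ E), bernoulliWeight p E =
      ∑ F ∈ (Tᶜ).powerset, bernoulliWeight p (T ∪ F) := by
    refine Finset.sum_nbij' (fun E => E \ T) (fun F => T ∪ F) ?_ ?_ ?_ ?_ ?_
    · intro E _
      rw [Finset.mem_powerset]
      intro x hx
      rw [Finset.mem_sdiff] at hx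
      exact Finset.mem_compl.2 hx.2
    · intro F hF
      rw [Finset.mem_filter]
      exact ⟨Finset.mem_univ _, Finset.subset_union_left⟩
    · intro E hE
      rw [Finset.mem_filter] at hE
      exact Finset.union_sdiff_of_subset hE.2
    · intro F hF
      rw [Finset.mem_powerset] at hF
      rw [Finset.union_sdiff_left]
      refine Finset.sdiff_eq_self_of_disjoint ?_
      exact Finset.disjoint_left.2 fun x hxF hxT => (Finset.mem_compl.1 (hF hxF)) hxT
    · intro E hE
      rw [Finset.mem_filter] at hE
      rw [Finset.union_sdiff_of_subset hE.2]
  rw [hbij]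
  have hcard : ∀ F ∈ (Tᶜ).powerset, (T ∪ F).card = T.card + F.card := by
    intro F hF
    rw [Finset.mem_powerset] at hF
    rw [Finset.card_union_of_disjoint]
    exact Finset.disjoint_left.2 fun x hxT hxF => (Finset.mem_compl.1 (hF hxF)) hxT
  have hrew : ∀ F ∈ (Tᶜ).powerset, bernoulliWeight p (T ∪ F) =
      p ^ T.card * (p ^ F.card * (1 - p) ^ ((Tᶜ).card - F.card)) := by
    intro F hF
    have hFc : F.card ≤ (Tᶜ).card := Finset.card_le_card (Finset.mem_powerset.1 hF)
    have hTc : (Tᶜ).card = Fintype.card V - T.card := Finset.card_compl T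
    have hTle : T.card ≤ Fintype.card V := Finset.card_le_univ T
    unfold bernoulliWeight
    rw [hcard F hF, pow_add]
    have : Fintype.card V - (T.card + F.card) = (Tᶜ).card - F.card := by rw [hTc]; omega
    rw [this]
    ring
  rw [Finset.sum_congr rfl hrew, ← Finset.mul_sum, Finset.sum_pow_mul_eq_add_pow,
    show p + (1 - p) = 1 by ring, one_pow, mul_one]

/-- The i.i.d. model with `0 ≤ p ≤ 1` is locally stochastic with parameter `p` (with equality in the defining
inequality). [cite: Gottesman2014, §2] -/
theorem isLocallyStochastic_bernoulliWeight {p : ℝ} (hp0 : 0 ≤ p) (hp1 : p ≤ 1) :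
    IsLocallyStochastic (bernoulliWeight (V := V) p) p :=
  ⟨bernoulliWeight_nonneg hp0 hp1, fun T => (sum_bernoulliWeight_filter_superset p T).le⟩

/-! ### Dense clusters -/

section Clusters

variable (G : SimpleGraph V) [DecidableRel G.Adj]

/-- `HasDenseCluster G d E`: some `G`-connected vertex set `S` of cardinality at least `d` has at least half of its
vertices in `E` (`|S| ≤ 2 |S ∩ E|`). This is the combinatorial event that every counting-bound threshold proof shows to
contain "minimum-weight decoding fails" for a code of distance `d` whose connectivity graph is `G`
(Gottesman 2014, proof of Thm. 3: "there must be some connected cluster of `s ≥ d_i` qubits such that the cluster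
contains `m ≥ ⌈s/2⌉` errors"; Kovalev–Pryadko 2013, proof of Thm. 3). [cite: Gottesman2014, Thm 3 (proof)] -/
def HasDenseCluster (d : ℕ) (E : Finset V) : Prop :=
  ∃ S : Finset V, IsGraphConnected G S ∧ d ≤ S.card ∧ S.card ≤ 2 * (S ∩ E).card

/-- The `G`-connected vertex sets of cardinality exactly `s` (the "clusters" / lattice animals of size `s`;
Kovalev–Pryadko 2013, Gottesman 2014 Lemma 2). [folklore] -/
def connectedOfCard (s : ℕ) : Finset (Finset V) :=
  univ.filter fun S => S.card = s ∧ IsGraphConnected G S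

variable {G}

/-- Membership in `connectedOfCard`. [folklore] -/
private theorem mem_connectedOfCard {s : ℕ} {S : Finset V} :
    S ∈ connectedOfCard G s ↔ S.card = s ∧ IsGraphConnected G S := by
  simp [connectedOfCard]

/-- **Entropy bound.** In a finite graph all of whose degrees are `≤ Δ`, the number of connected vertex sets of
cardinality `s ≥ 1` is at most `|V| · Δ^{2(s-1)}`: each such set contains some vertex `v`, and through a fixed `v`
there are at most `Δ^{2(s-1)}` of them (`card_le_pow_of_isGraphConnected`, Friedli–Velenik Lemma 3.38).
Gottesman 2014 Lemma 2 / Kovalev–Pryadko 2013 use the sharper lattice-animal count; only the constant differs.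
[cite: Gottesman2014, Lemma 2 (weaker constant)] -/
theorem card_connectedOfCard_le {Δ : ℕ} (hΔ : ∀ x, G.degree x ≤ Δ) {s : ℕ} (hs : 1 ≤ s) :
    (connectedOfCard G s).card ≤ Fintype.card V * Δ ^ (2 * (s - 1)) := by
  classical
  -- cover by the families through each vertex
  have hcover : connectedOfCard G s ⊆
      (univ : Finset V).biUnion fun v => (connectedOfCard G s).filter fun S => v ∈ S := by
    intro S hS
    rw [Finset.mem_biUnion]
    have hScard : S.card = s := (mem_connectedOfCard.1 hS).1
    have hne : S.Nonempty := by rw [← Finset.card_pos, hScard]; exact hs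
    obtain ⟨v, hv⟩ := hne
    exact ⟨v, Finset.mem_univ v, Finset.mem_filter.2 ⟨hS, hv⟩⟩
  refine (Finset.card_le_card hcover).trans ((Finset.card_biUnion_le).trans ?_)
  have hv : ∀ v ∈ (univ : Finset V),
      ((connectedOfCard G s).filter fun S => v ∈ S).card ≤ Δ ^ (2 * (s - 1)) := by
    intro v _
    refine card_le_pow_of_isGraphConnected hΔ (v := v) (n := s) _ ?_
    intro S hS
    rw [Finset.mem_filter, mem_connectedOfCard] at hS
    exact ⟨hS.2, hS.1.1, hS.1.2⟩
  refine (Finset.sum_le_sum hv).trans ?_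
  simp

/-- Sums over a union of events are at most the sum of the sums (nonnegative weights). [folklore] -/
private theorem sum_biUnion_le_sum {α β : Type*} [DecidableEq β] (T : Finset α) (B : α → Finset β) (W : β → ℝ)
    (hW : ∀ b, 0 ≤ W b) : ∑ b ∈ T.biUnion B, W b ≤ ∑ a ∈ T, ∑ b ∈ B a, W b := by
  classical
  induction T using Finset.induction_on with
  | empty => simp
  | insert a T ha ih =>
    rw [Finset.biUnion_insert, Finset.sum_insert ha]
    have hu : ∑ b ∈ B a ∪ T.biUnion B, W b ≤ ∑ b ∈ B a, W b + ∑ b ∈ T.biUnion B, W b := by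
      rw [← Finset.sum_union_inter]
      have : 0 ≤ ∑ b ∈ B a ∩ T.biUnion B, W b := sum_nonneg fun b _ => hW b
      linarith
    linarith

/-- The weight of "at least half of a FIXED set `S` is faulty" under a locally stochastic weight with parameter
`p ∈ [0,1]` is at most `(2 √p)^{|S|}`: there are at most `2^{|S|}` subsets `T ⊆ S` with `2|T| ≥ |S|`, and for each the
error sets with `S ∩ E = T` are among those containing `T`, of total weight `≤ p^{|T|} ≤ (√p)^{|S|}`.
(Gottesman 2014, proof of Thm. 3: "the probability of having at least `⌈s/2⌉` errors in `S` is at most `2^s p^{s/2}`".)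
[cite: Gottesman2014, Thm 3 (proof)] -/
theorem sum_filter_dense_le {μ : Finset V → ℝ} {p : ℝ} (hμ : IsLocallyStochastic μ p) (hp0 : 0 ≤ p)
    (hp1 : p ≤ 1) (S : Finset V) :
    ∑ E ∈ univ.filter (fun E => S.card ≤ 2 * (S ∩ E).card), μ E ≤ (2 * Real.sqrt p) ^ S.card := by
  classical
  set halves : Finset (Finset V) := S.powerset.filter fun T => S.card ≤ 2 * T.card with hhalves
  -- the event is covered by the events `T ⊆ E`, `T ∈ halves` (take `T = S ∩ E`)
  have hcover : univ.filter (fun E => S.card ≤ 2 * (S ∩ E).card) ⊆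
      halves.biUnion fun T => univ.filter fun E => T ⊆ E := by
    intro E hE
    rw [Finset.mem_filter] at hE
    rw [Finset.mem_biUnion]
    refine ⟨S ∩ E, ?_, ?_⟩
    · rw [hhalves, Finset.mem_filter, Finset.mem_powerset]
      exact ⟨Finset.inter_subset_left, hE.2⟩
    · rw [Finset.mem_filter]
      exact ⟨Finset.mem_univ _, Finset.inter_subset_right⟩
  have hsqrt0 : 0 ≤ Real.sqrt p := Real.sqrt_nonneg p
  have hsqrt1 : Real.sqrt p ≤ 1 := by simpa using Real.sqrt_le_sqrt hp1
  have hstep1 : ∑ E ∈ univ.filter (fun E => S.card ≤ 2 * (S ∩ E).card), μ E ≤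
      ∑ T ∈ halves, ∑ E ∈ univ.filter (fun E => T ⊆ E), μ E :=
    (Finset.sum_le_sum_of_subset_of_nonneg hcover fun E _ _ => hμ.nonneg E).trans
      (sum_biUnion_le_sum halves _ μ hμ.nonneg)
  have hstep2 : ∀ T ∈ halves, ∑ E ∈ univ.filter (fun E => T ⊆ E), μ E ≤ (Real.sqrt p) ^ S.card := by
    intro T hT
    rw [hhalves, Finset.mem_filter, Finset.mem_powerset] at hT
    refine (hμ.sum_filter_superset_le T).trans ?_
    -- `p ^ |T| = (√p)^(2|T|) ≤ (√p)^|S|` since `2|T| ≥ |S|` and `√p ≤ 1`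
    have hpT : p ^ T.card = (Real.sqrt p) ^ (2 * T.card) := by
      rw [pow_mul, Real.sq_sqrt hp0]
    rw [hpT]
    exact pow_le_pow_of_le_one hsqrt0 hsqrt1 hT.2
  have hstep3 : ∑ T ∈ halves, ∑ E ∈ univ.filter (fun E => T ⊆ E), μ E ≤
      (halves.card : ℝ) * (Real.sqrt p) ^ S.card := by
    have := Finset.sum_le_sum hstep2
    refine this.trans ?_
    rw [Finset.sum_const, nsmul_eq_mul]
  have hhalves_card : (halves.card : ℝ) ≤ (2 : ℝ) ^ S.card := by
    have h1 : halves.card ≤ S.powerset.card := Finset.card_filter_le _ _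
    rw [Finset.card_powerset] at h1
    exact_mod_cast h1
  calc ∑ E ∈ univ.filter (fun E => S.card ≤ 2 * (S ∩ E).card), μ E
      ≤ (halves.card : ℝ) * (Real.sqrt p) ^ S.card := hstep1.trans hstep3
    _ ≤ (2 : ℝ) ^ S.card * (Real.sqrt p) ^ S.card :=
        mul_le_mul_of_nonneg_right hhalves_card (pow_nonneg hsqrt0 _)
    _ = (2 * Real.sqrt p) ^ S.card := by rw [mul_pow]

/-- **The cluster-counting union bound** (probabilistic core of Kovalev–Pryadko 2013 Thm. 3 / Gottesman 2014 Thm. 3).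
In a finite graph with all degrees `≤ Δ`, for a locally stochastic weight `μ` with parameter `p ∈ [0,1]`, the total
weight of the error sets admitting a connected cluster of size `≥ d` that is at least half faulty satisfies
`∑_{E : HasDenseCluster G d E} μ E ≤ ∑_{s=d}^{|V|} |V| · Δ^{2(s-1)} · (2√p)^s`.
(Union bound over the connected `S` of each size `s ≥ d` — at most `|V| Δ^{2(s-1)}` of them,
`card_connectedOfCard_le` — times the bound `(2√p)^s` of `sum_filter_dense_le` for each.) [cite: Gottesman2014, Thm 3 (proof)] -/
theorem sum_hasDenseCluster_le {Δ : ℕ} (hΔ : ∀ x, G.degree x ≤ Δ) {μ : Finset V → ℝ} {p : ℝ}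
    (hμ : IsLocallyStochastic μ p) (hp0 : 0 ≤ p) (hp1 : p ≤ 1) {d : ℕ} (hd : 1 ≤ d)
    [DecidablePred (HasDenseCluster G d)] :
    ∑ E ∈ univ.filter (fun E => HasDenseCluster G d E), μ E ≤
      ∑ s ∈ Finset.Icc d (Fintype.card V),
        (Fintype.card V : ℝ) * (Δ : ℝ) ^ (2 * (s - 1)) * (2 * Real.sqrt p) ^ s := by
  classical
  -- all connected sets of size ≥ d
  set clusters : Finset (Finset V) :=
    (Finset.Icc d (Fintype.card V)).biUnion fun s => connectedOfCard G s with hclusters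
  have hcover : univ.filter (fun E => HasDenseCluster G d E) ⊆
      clusters.biUnion fun S => univ.filter fun E => S.card ≤ 2 * (S ∩ E).card := by
    intro E hE
    rw [Finset.mem_filter] at hE
    obtain ⟨S, hSconn, hdS, hSE⟩ := hE.2
    rw [Finset.mem_biUnion]
    refine ⟨S, ?_, Finset.mem_filter.2 ⟨Finset.mem_univ _, hSE⟩⟩
    rw [hclusters, Finset.mem_biUnion]
    refine ⟨S.card, Finset.mem_Icc.2 ⟨hdS, Finset.card_le_univ S⟩, mem_connectedOfCard.2 ⟨rfl, hSconn⟩⟩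
  have h1 : ∑ E ∈ univ.filter (fun E => HasDenseCluster G d E), μ E ≤
      ∑ S ∈ clusters, ∑ E ∈ univ.filter (fun E => S.card ≤ 2 * (S ∩ E).card), μ E :=
    (Finset.sum_le_sum_of_subset_of_nonneg hcover fun E _ _ => hμ.nonneg E).trans
      (sum_biUnion_le_sum clusters _ μ hμ.nonneg)
  have h2 : ∑ S ∈ clusters, ∑ E ∈ univ.filter (fun E => S.card ≤ 2 * (S ∩ E).card), μ E ≤
      ∑ S ∈ clusters, (2 * Real.sqrt p) ^ S.card :=
    Finset.sum_le_sum fun S _ => sum_filter_dense_le hμ hp0 hp1 S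
  -- regroup the clusters by size (the union over sizes is disjoint)
  have hr0 : 0 ≤ 2 * Real.sqrt p := mul_nonneg zero_le_two (Real.sqrt_nonneg p)
  have h3 : ∑ S ∈ clusters, (2 * Real.sqrt p) ^ S.card ≤
      ∑ s ∈ Finset.Icc d (Fintype.card V), ∑ S ∈ connectedOfCard G s, (2 * Real.sqrt p) ^ S.card := by
    rw [hclusters]
    exact sum_biUnion_le_sum _ _ _ fun S => pow_nonneg hr0 _
  have h4 : ∀ s ∈ Finset.Icc d (Fintype.card V),
      ∑ S ∈ connectedOfCard G s, (2 * Real.sqrt p) ^ S.card ≤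
        (Fintype.card V : ℝ) * (Δ : ℝ) ^ (2 * (s - 1)) * (2 * Real.sqrt p) ^ s := by
    intro s hs
    have hs1 : 1 ≤ s := hd.trans (Finset.mem_Icc.1 hs).1
    have hconst : ∑ S ∈ connectedOfCard G s, (2 * Real.sqrt p) ^ S.card =
        ((connectedOfCard G s).card : ℝ) * (2 * Real.sqrt p) ^ s := by
      rw [Finset.sum_congr rfl fun S hS => by rw [(mem_connectedOfCard.1 hS).1], Finset.sum_const,
        nsmul_eq_mul]
    rw [hconst]
    refine mul_le_mul_of_nonneg_right ?_ (pow_nonneg hr0 _)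
    exact_mod_cast card_connectedOfCard_le hΔ hs1
  exact h1.trans (h2.trans (h3.trans (Finset.sum_le_sum h4)))

/-- **Geometric form** (the shape of Gottesman 2014 Thm. 3 / Kovalev–Pryadko 2013 Thm. 3 with the tree's animal
constant): if `1 ≤ Δ`, `1 ≤ d` and `r := 2 Δ² √p < 1`, then
`∑_{E : HasDenseCluster G d E} μ E ≤ |V| · r^d / (Δ² (1 - r))`. Hence along a family of bounded-degree connectivity
graphs with `d → ∞` and `|V| = e^{o(d)}` the weight of the dense-cluster event tends to `0` whenever
`p < p₀ := (2Δ²)⁻²` — the threshold. [cite: Gottesman2014, Thm 3] -/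
theorem sum_hasDenseCluster_le_geometric {Δ : ℕ} (hΔ : ∀ x, G.degree x ≤ Δ) (hΔ1 : 1 ≤ Δ)
    {μ : Finset V → ℝ} {p : ℝ} (hμ : IsLocallyStochastic μ p) (hp0 : 0 ≤ p) (hp1 : p ≤ 1) {d : ℕ} (hd : 1 ≤ d)
    [DecidablePred (HasDenseCluster G d)] (hr : 2 * (Δ : ℝ) ^ 2 * Real.sqrt p < 1) :
    ∑ E ∈ univ.filter (fun E => HasDenseCluster G d E), μ E ≤
      (Fintype.card V : ℝ) * (2 * (Δ : ℝ) ^ 2 * Real.sqrt p) ^ d /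
        ((Δ : ℝ) ^ 2 * (1 - 2 * (Δ : ℝ) ^ 2 * Real.sqrt p)) := by
  classical
  set r : ℝ := 2 * (Δ : ℝ) ^ 2 * Real.sqrt p with hrdef
  have hr0 : 0 ≤ r := by rw [hrdef]; positivity
  have hΔpos : (0 : ℝ) < (Δ : ℝ) ^ 2 := by positivity
  have hn0 : (0 : ℝ) ≤ Fintype.card V := Nat.cast_nonneg _
  refine (sum_hasDenseCluster_le hΔ hμ hp0 hp1 hd).trans ?_
  -- each term equals |V| / Δ² · r^s
  have hterm : ∀ s ∈ Finset.Icc d (Fintype.card V),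
      (Fintype.card V : ℝ) * (Δ : ℝ) ^ (2 * (s - 1)) * (2 * Real.sqrt p) ^ s =
        (Fintype.card V : ℝ) / (Δ : ℝ) ^ 2 * r ^ s := by
    intro s hs
    have hs1 : 1 ≤ s := hd.trans (Finset.mem_Icc.1 hs).1
    obtain ⟨t, rfl⟩ : ∃ t, s = t + 1 := ⟨s - 1, by omega⟩
    simp only [Nat.add_sub_cancel, hrdef]
    field_simp
    ring
  rw [Finset.sum_congr rfl hterm, ← Finset.mul_sum]
  have hgeom : ∑ s ∈ Finset.Icc d (Fintype.card V), r ^ s ≤ r ^ d / (1 - r) := by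
    have hIcc : Finset.Icc d (Fintype.card V) = Finset.Ico d (Fintype.card V + 1) := by
      ext s; simp only [Finset.mem_Icc, Finset.mem_Ico]; omega
    rw [hIcc]
    exact geom_sum_Ico_le_of_lt_one hr0 hr
  calc (Fintype.card V : ℝ) / (Δ : ℝ) ^ 2 * ∑ s ∈ Finset.Icc d (Fintype.card V), r ^ s
      ≤ (Fintype.card V : ℝ) / (Δ : ℝ) ^ 2 * (r ^ d / (1 - r)) :=
        mul_le_mul_of_nonneg_left hgeom (div_nonneg hn0 hΔpos.le)
    _ = (Fintype.card V : ℝ) * r ^ d / ((Δ : ℝ) ^ 2 * (1 - r)) := by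
        rw [div_mul_div_comm]

end Clusters

end Literature.InformationTheory.QuantumCodes
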